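import Summits.AnomalousDissipation.AnomalousDissipation.Theorems.SolenoidalFractalHomogenisationLagrangianStepVmodSfCoarseLong
import Summits.AnomalousDissipation.AnomalousDissipation.Theorems.SolenoidalFractalHomogenisationLagrangianStepVmodSSSmall
import HarnessLib

/-!
# K1L_D (stmt-AnomalousDissipation-27980): (V_mod) flat stage, block (sf) — THE COARSE-LABEL DISPATCH at grid phase (long windows), constants as
# hypotheses (prover ad-k3l-bookkeeping-p1 g10, (sf) owner by RULING D28-5; grid family of record by RULING D28-9; helper `--supports 27980`)

The (sf) twin of prover ad-sawtooth-k1loc-p1 g15's `…VmodSSDispatch` restricted to what the (sf) text `SFModeP_textEVH` asks: LONG windows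
(`M·W.period/ν < t − s`), grid start `s = j₀·(M·W.period/ν)`, COARSE nonzero slow labels (`‖ℓ‖⌈K/ν⌉ ≤ g₀·n`), a pair datum `w`, a fast test `ζ`.
Three leaves: `Rτ ≤ 2` → MID row `sideband_le_alw_of_scale_mid` (L-sb `cS ≤ cSp√u`); `Rτ > 2`, `t₀ ≤ ν` → ν-FLOOR row `sideband_le_alw_of_nufloor`
(with `u ≤ 1` from coarseness, `RP_le_one_of_coarse`); `Rτ > 2`, `ν < t₀` → p1's `coarse_smallness` (p717612) feeds the LONG row
`sideband_le_alw_of_scale_iter`.  The pairing is reduced to the sideband by `abs_inner_le_sideband_mul_norm` (fast test ⊥ pair part):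

  `|⟪U s t w, ζ⟫| ≤ (C₁(C₁(ν^e + (⌈K/ν⌉/n)^e) + (min 1 (P/τ))^e)) · √(dW lo Λ c ν n τ ℓ) · ‖w‖ · ‖ζ‖`   (`pairing_le_alw_dispatch_coarse`).

The constants (`g₀`, `t₀`, `C₁`) are CHOSEN in the companion `…VmodSfModeGrid`.  `sorry`-free; NOT a proof of (sf), of the stub, of K1L_D or
of AD; rung F-D1.A0.
-/

set_option linter.dupNamespace false

noncomputable section

namespace Summit.AnomalousDissipation.AnomalousDissipation.Theorems.SolenoidalFractalHomogenisation.LagrangianStep.VmodGen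

open Set MeasureTheory Complex UnitAddTorus
open scoped InnerProductSpace ENNReal
open Literature.Analysis Literature.Analysis.FunctionSpaces Literature.Analysis.FunctionSpaces.Torus
open Literature.Analysis.FluidPDE Literature.Analysis.FluidPDE.Torus Literature.Analysis.FluidPDE.LatticeShear
open Summit.AnomalousDissipation.AnomalousDissipation.Theorems.SolenoidalFractalHomogenisation.LagrangianStep.Sideband (slotAmp)
open Summit.AnomalousDissipation.AnomalousDissipation.Theorems.SolenoidalFractalHomogenisation.LagrangianStep.VmodFlat (fc loT dW IsFast)

/-! ## §1 `u = RP ≤ 1` on coarse labels (p1's step, without the `ν ≤ ν_c` binder) -/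

/-- **`RP ≤ 1` from coarseness** (`‖ℓ‖⌈K/ν⌉ ≤ g₀n`, `0 < ν ≤ 1`, and the `g₀`-condition `hA`; the `ν ≤ ν_c` hypothesis of `coarse_smallness` is
not used for this conjunct). -/
theorem RP_le_one_of_coarse {k : ℕ} (W : LatticeWord k) {C c lo hi Λ M ν K g₀ : ℝ} {n : ℕ} {ℓ : Fin 3 → ℤ}
    (hC : 0 ≤ C) (hc : 0 < c) (hlo : 0 < lo) (hhi : 0 ≤ hi) (hΛ : 1 ≤ Λ) (hM : 0 < M)
    (hν : 0 < ν) (hν1 : ν ≤ 1) (hK : 0 < K) (hn : 1 ≤ n) (hℓ0 : ℓ ≠ 0) (hg₀ : 0 < g₀) (hg₀1 : g₀ ≤ 1)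
    (hcoarse : ‖Torus.latticeVec ℓ‖ * (⌈K / ν⌉₊ : ℝ) ≤ g₀ * n)
    (hA : 8 * Real.pi ^ 2 * (lo / Λ) * (M * W.period) * (1 + c) / K ^ 2 * g₀
      ≤ 1 / (50 * (2 * Real.sqrt 2 * C * (hi * Λ ^ 2 / lo) + 1))) :
    8 * Real.pi ^ 2 * loT lo Λ c ν n * Torus.freqNormSq ℓ * (M * W.period / ν) ≤ 1 := by
  have hn0 : (0:ℝ) < n := by exact_mod_cast (show 0 < n from hn)
  have hΛ0 : 0 < Λ := lt_of_lt_of_le one_pos hΛ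
  have hloΛ : 0 < lo / Λ := div_pos hlo hΛ0
  have hWp := PermissibleCarrier.period_pos W
  have hMW : 0 < M * W.period := mul_pos hM hWp
  have hL0 : 0 < ‖Torus.latticeVec ℓ‖ := by
    refine norm_pos_iff.2 fun h => hℓ0 ?_
    funext i
    have hi := congrArg (fun w : EuclideanSpace ℝ (Fin 3) => w i) h
    simpa [Torus.latticeVec_apply] using hi
  set L : ℝ := ‖Torus.latticeVec ℓ‖ with hL
  set q : ℝ := Torus.freqNormSq ℓ with hq
  have hqL : q = L ^ 2 := by rw [hq, hL, norm_latticeVec_sq_eq]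
  have hq0 : 0 < q := by rw [hqL]; positivity
  set r₀ : ℝ := hi * Λ ^ 2 / lo with hr₀
  have hr₀0 : 0 ≤ r₀ := by rw [hr₀]; positivity
  have hceil : K / ν ≤ (⌈K / ν⌉₊ : ℝ) := Nat.le_ceil _
  have hLnν : L / (n * ν) ≤ g₀ / K := by
    have h1 : L * (K / ν) ≤ g₀ * n := (mul_le_mul_of_nonneg_left hceil hL0.le).trans hcoarse
    rw [div_le_div_iff₀ (by positivity) hK]
    have := mul_le_mul_of_nonneg_right h1 hν.le
    calc L * K = L * (K / ν) * ν := by field_simp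
      _ ≤ g₀ * n * ν := this
      _ = g₀ * (n * ν) := by ring
  have hLnν0 : 0 ≤ L / (n * ν) := by positivity
  have hqn : q / ((n:ℝ) ^ 2 * ν ^ 2) ≤ g₀ ^ 2 / K ^ 2 := by
    have := pow_le_pow_left₀ hLnν0 hLnν 2
    rw [div_pow, div_pow, mul_pow] at this
    rwa [hqL]
  set u : ℝ := 8 * Real.pi ^ 2 * loT lo Λ c ν n * q * (M * W.period / ν) with hu
  have hu_eq : u = 8 * Real.pi ^ 2 * (lo / Λ) * (M * W.period) * ((ν ^ 2 + c) * (q / ((n:ℝ) ^ 2 * ν ^ 2))) := by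
    rw [hu]; unfold loT; field_simp
  have hu_le : u ≤ 8 * Real.pi ^ 2 * (lo / Λ) * (M * W.period) * (1 + c) / K ^ 2 * g₀ ^ 2 := by
    rw [hu_eq]
    have h1 : (ν ^ 2 + c) * (q / ((n:ℝ) ^ 2 * ν ^ 2)) ≤ (1 + c) * (g₀ ^ 2 / K ^ 2) :=
      mul_le_mul (by nlinarith) hqn (by positivity) (by positivity)
    have := mul_le_mul_of_nonneg_left h1 (by positivity : 0 ≤ 8 * Real.pi ^ 2 * (lo / Λ) * (M * W.period))
    refine this.trans (le_of_eq ?_); ring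
  have hδ : u ≤ 1 / (50 * (2 * Real.sqrt 2 * C * r₀ + 1)) := by
    refine hu_le.trans (le_trans ?_ hA)
    have h0 : 0 ≤ 8 * Real.pi ^ 2 * (lo / Λ) * (M * W.period) * (1 + c) / K ^ 2 := by positivity
    have : g₀ ^ 2 ≤ g₀ := by nlinarith
    exact mul_le_mul_of_nonneg_left this h0
  exact hδ.trans (by
    rw [div_le_one (by positivity)]; nlinarith [mul_nonneg (mul_nonneg (by positivity : (0:ℝ) ≤ 2 * Real.sqrt 2) hC) hr₀0])

/-! ## §2 The coarse dispatch -/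

section Clause

variable {k : ℕ} {W : LatticeWord k} {M : ℝ} {hM : 0 < M} {c : ℝ}
  {Φ : ℝ → Visc4 (Fin 3) → Visc4 (Fin 3)} {lo hi Λ β σ C ν₀ K : ℝ}
  {ν : ℝ} {n : ℕ} {𝔸 : Visc4 (Fin 3)} {Tw : ℝ} {U T : ℝ → ℝ → (V2 →L[ℝ] V2)}

set_option maxHeartbeats 3200000 in
/-- **THE COARSE-LABEL DISPATCH OF (sf)** (grid start, long window, pair datum, fast test; constants as hypotheses).  See the module docstring. -/
theorem pairing_le_alw_dispatch_coarse (hV : SlowVectorClauseF W M hM c Φ lo hi Λ β σ C ν₀ K)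
    (hlo : 0 < lo) (hhi : 1 ≤ hi) (hΛ : 1 < Λ) (hσ : 0 < σ) (hC : 0 ≤ C) (hν₀1 : ν₀ ≤ 1) (hK : 0 < K) (hc : 0 < c)
    {e : ℝ} (he0 : 0 < e) (he12 : e ≤ 1 / 2)
    {g₀ t₀ C₁ : ℝ} (hg₀0 : 0 < g₀) (hg₀1 : g₀ ≤ 1)
    (hgσ : 2 * Real.sqrt 2 * C ^ 2 * g₀ ^ σ ≤ 1 / 50) (ht₀0 : 0 < t₀) (hνcσ : 2 * Real.sqrt 2 * C ^ 2 * t₀ ^ σ ≤ 1 / 50)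
    (hAg : (8 * Real.pi ^ 2 * (lo / Λ) * (M * W.period) * (1 + c) / K ^ 2) * g₀ ≤ (1 / (50 * (2 * Real.sqrt 2 * C * (hi * Λ ^ 2 / lo) + 1))))
    (hBg : (12 * k * Real.exp (9 * (k : ℝ) ^ 2 / (2 * Real.pi ^ 4 * (lo / Λ) ^ 2 * c)) / (Real.pi ^ 2 * (lo / Λ) * K)) * g₀ ≤ 1 / 50)
    (hBsg : (24 * (∑ j, ‖slotAmp W j‖) / (Real.pi * (lo / Λ) * K)) * g₀ ≤ 1 / 50)
    (hgd : 16 * (1 + c) * g₀ / K ^ 2 ≤ 1 / 50)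
    (hC₁0 : 0 ≤ C₁)
    (hC₁m : 2 * (8 * (∑ j, ‖slotAmp W j‖) / (Real.pi * (lo / Λ) * Real.sqrt (8 * Real.pi ^ 2 * (lo / Λ) * (M * W.period) * c))) ≤ C₁)
    (hC₁f : 2 * (8 * (∑ j, ‖slotAmp W j‖) / (Real.pi * (lo / Λ) * Real.sqrt (8 * Real.pi ^ 2 * (lo / Λ) * (M * W.period) * c)))
      ≤ C₁ * C₁ * t₀ ^ e)
    (hC₁s : 3750 * (8 * (∑ j, ‖slotAmp W j‖) / (Real.pi * (lo / Λ) * Real.sqrt (8 * Real.pi ^ 2 * (lo / Λ) * (M * W.period) * c))) ≤ C₁)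
    (hν : ν ∈ Set.Ioo 0 ν₀) (hn : (⌈K / ν⌉₊ : ℝ) ≤ n) (hodd : OddSmall 𝔸 (ν * β))
    (hwin : ∃ lam ∈ Set.Icc (1:ℝ) Λ, NearIso 𝔸 (ν * (lo / lam)) (ν * (hi * lam)))
    (hΦw : ∃ lam ∈ Set.Icc (1:ℝ) Λ, NearIso (Φ ν ((1 / ν) • 𝔸)) (lo / lam) (hi * lam))
    (hU : IsPropagator Tw (cellField W M hM ν hν.1 n) ((1 / (n:ℝ) ^ 2) • 𝔸) U)
    (hT : IsPropagator Tw (fun (_ : ℝ) (_ : UnitAddTorus (Fin 3)) => (0 : EuclideanSpace ℝ (Fin 3)))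
      ((1 / (n:ℝ) ^ 2) • (𝔸 + (c / ν) • Φ ν ((1 / ν) • 𝔸))) T)
    {s t : ℝ} (hst : s < t) (htT : t ≤ Tw) (j₀ : ℕ) (hs₀ : s = j₀ * (M * W.period / ν)) (hPτ : M * W.period / ν < t - s)
    {ℓ : Fin 3 → ℤ} (hℓ : ℓ ∈ (Torus.freqBall (d := Fin 3) (n / 4)).erase 0) (hco : ‖Torus.latticeVec ℓ‖ * (⌈K / ν⌉₊ : ℝ) ≤ g₀ * n)
    (w : V2) (hw : w ∈ divFreeL2 (Fin 3)) (hws : ∀ k', k' ≠ ℓ → k' ≠ -ℓ → fc w k' = 0) (ζ : V2) (hζ : IsFast n ζ) :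
    |⟪U s t w, ζ⟫_ℝ|
      ≤ (C₁ * (C₁ * (ν ^ e + ((⌈K / ν⌉₊ : ℝ) / n) ^ e) + (min 1 ((M * W.period / ν) / (t - s))) ^ e))
        * Real.sqrt (dW lo Λ c ν n (t - s) ℓ) * ‖w‖ * ‖ζ‖ := by
  have hΛ1 : 1 ≤ Λ := hΛ.le
  have hhi0 : 0 ≤ hi := by linarith only [hhi]
  have hν1 : ν ≤ 1 := hν.2.le.trans hν₀1
  have hceil1 : (1:ℝ) ≤ (⌈K / ν⌉₊ : ℝ) := by
    exact_mod_cast Nat.one_le_iff_ne_zero.2 (Nat.pos_iff_ne_zero.1 (Nat.ceil_pos.2 (div_pos hK hν.1)))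
  have hn1 : 1 ≤ n := by exact_mod_cast (hceil1.trans hn)
  have hn0 : (0:ℝ) < n := by exact_mod_cast (show 0 < n from hn1)
  obtain ⟨hℓ0, hℓB⟩ := Finset.mem_erase.1 hℓ
  have hLb : 2 * (n / 4) < n := by omega
  have hscale : ‖Torus.latticeVec ℓ‖ * (⌈K / ν⌉₊ : ℝ) ≤ n := hco.trans (by nlinarith only [hg₀1, hn0])
  -- the sideband controls the pairing with a fast test
  have hUw : U s t w ∈ divFreeL2 (Fin 3) := (mem_divFreeL2_iff _).2 (hU.divFree s t w)
  have hpair := VmodGen.abs_inner_le_sideband_mul_norm hℓ0 hℓB (U s t w) hUw ζ hζ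
  refine hpair.trans (mul_le_mul_of_nonneg_right ?_ (norm_nonneg _))
  -- ### the dispatch on the window length and on ν
  by_cases hR2 : 8 * Real.pi ^ 2 * loT lo Λ c ν n * Torus.freqNormSq ℓ * (t - s) ≤ 2
  · exact sideband_le_alw_of_scale_mid hlo hhi0 hΛ1 hc hν hn1 hwin hU j₀ hs₀ htT hLb hℓ0 hℓB w hw hws hC₁0 hC₁m he12 hPτ hR2
  · rw [not_le] at hR2
    by_cases hνc : t₀ ≤ ν
    · have hRP := RP_le_one_of_coarse W hC hc hlo hhi0 hΛ1 hM hν.1 hν1 hK hn1 hℓ0 hg₀0 hg₀1 hco hAg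
      exact sideband_le_alw_of_nufloor hlo hhi0 hΛ1 hc hν hn1 hwin hU j₀ hs₀ htT hLb hℓ0 hℓB w hw hws hC₁0 ht₀0 hνc hC₁f he0.le
        hPτ hRP
    · rw [not_le] at hνc
      obtain ⟨hRP, hρ⟩ := coarse_smallness W hC hσ hc hlo hhi0 hΛ1 hM hν.1 hν1 hK hn1 hℓ0 hg₀0 hg₀1 hνc.le hco hgσ hνcσ
        hAg hBg hBsg hgd
      exact sideband_le_alw_of_scale_iter hV hlo hhi0 hΛ1 hc hC hK.le hν hn1 hodd hwin hΦw hU hT j₀ hs₀ hst htT hLb hℓ0 hℓB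
        hscale w hw hws hC₁0 hC₁s he12 hρ hRP hR2.le

end Clause

end Summit.AnomalousDissipation.AnomalousDissipation.Theorems.SolenoidalFractalHomogenisation.LagrangianStep.VmodGen

end
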